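import Summits.BirchSwinnertonDyer.BirchSwinnertonDyer.Theorems.SignedLowerHalvesKobayashiLowerHalfSemistableSignLattices

/-!
# Route `SignedLowerHalves`, crux `KobayashiLowerHalfSemistable` (item stmt-BirchSwinnertonDyer-19000): the SIGN SYMMETRY
# of p471034's lattice model (`…Theorems.SignLattices`) and the `ε = −` twins it omitted — REPORT-bstw-11 o2 (cell
# `bsd-ssimc`, seat `bsd-ssimc-k3-c2` gen 16, object «SIGN-MIRROR»; `--supports stmt-BirchSwinnertonDyer-19000 --as helper`:
# closes nothing; p471034 is NOT edited — append-only successor file)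

PARTITION (cell bsd-ssimc): X6 ∧ r = 0 (A6) × the 12 cells at `p = 3` + X6 r1 @ 3 + D2 literal @ 3 — types-the-object-of
(the commutative algebra of bstw-MEMO-11 Theorems A/B when the (F3)-class of `𝕋̃` is `J⁻`); closes NONE; nothing booked.
HONEST FRAMING: pure commutative algebra over a commutative ring `R` in p471034's vocabulary (`𝕃′ = t • ⊤`,
`𝕃^± = t • ⊤ ⊔ R ∙ (1, ±1)`, `𝕃″ = ⊤`, `c` = swap, `(t)`-saturation); NOT Theorems A/B/C, NOT B1, NOT a binder, NO tier
word; crux 2's kernel state (p441716) and why-text of record (rev 15, (L1″)) untouched; BSD is not proved by any of this.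
Sources: REPORT-bstw-11 (49cae1424c3af3a3) o2 «the ε = − mirror of `eq_of_plus_le` … a successor file suffices
(append-only; do NOT edit p471034)»; p471034's docstring «sign-`-` twins … omitted for the 400-line cap», §5 «the sign
`-` is symmetric»; bstw-MEMO-11 cb85d30b99168706 §1 (F3), §3, §4; BSTW arXiv:2409.01350v2 I Lemmas 3.14–3.15 (objects only).

WHAT IS KERNEL-CHECKED. §1 the SIGN FLIP `φ : (x₁, x₂) ↦ (x₁, -x₂)` (`LinearMap.id.prodMap (-LinearMap.id)`; `e_v̄ ↦ -e_v̄`):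
`φ` FIXES `t • ⊤` and `⊤`, EXCHANGES `𝕃⁺ ↔ 𝕃⁻` (`map_flip_smul_top/top/plus/minus`) and PRESERVES the hypotheses of the
classification `eq_of_swap_stable_of_saturated` (`swap_stable_map_flip`, `saturated_map_flip`) — the kernel form of
«the sign `-` is symmetric». §2 the omitted twins, proved directly: `saturated_minus`, `minus_inf_fst_axis` (Lemma
3.15(ii) for `𝕃⁻`), `minus_lt_top`, `minus_ne_inf_sup_inf`, **`eq_of_minus_le`** (= o2: Theorem A Case `D_v = 1` /
Theorem B rigidity when `𝕋̃ = J⁻`). §3 SIGN-UNIFORM rigidity (`s = 1 ∨ s = -1`): `eq_of_signed_le`,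
`eq_signed_of_saturated_of_le`. Design: THEOREMS ONLY (no def / structure / instance / notation / named fact).
-/

open Pointwise

-- lint debt, justified: the Theorems namespace repeats the summit name (D-0017); `dupNamespace` flags every decl.
set_option linter.dupNamespace false

namespace Summit.BirchSwinnertonDyer.BirchSwinnertonDyer.Theorems.SignLattices

variable {R : Type*} [CommRing R]

/-! ## §1 The sign flip `φ = (x₁, x₂) ↦ (x₁, -x₂)` permutes the four classified lattices and preserves the hypotheses -/

/-- Membership in the flipped lattice: `x ∈ φ(L) ⟺ (x₁, -x₂) ∈ L` (`φ` is an involution). -/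
theorem mem_map_flip_iff (L : Submodule R (R × R)) (x : R × R) :
    x ∈ L.map ((LinearMap.id : R →ₗ[R] R).prodMap (-LinearMap.id)) ↔ (x.1, -x.2) ∈ L := by
  constructor
  · rintro ⟨y, hy, rfl⟩
    simpa using hy
  · intro h
    exact ⟨(x.1, -x.2), h, by ext <;> simp⟩

/-- `φ` fixes the induced lattice `𝕃′ = t • ⊤`, elementwise. -/
theorem flip_mem_smul_top_iff (t : R) (x : R × R) :
    (x.1, -x.2) ∈ t • (⊤ : Submodule R (R × R)) ↔ x ∈ t • (⊤ : Submodule R (R × R)) := by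
  rw [mem_smul_top_iff, mem_smul_top_iff]
  exact and_congr Iff.rfl dvd_neg

/-- `φ` carries `𝕃⁻` onto `𝕃⁺`, elementwise: `(x₁, -x₂) ∈ 𝕃⁺ ⟺ x ∈ 𝕃⁻`. -/
theorem flip_mem_plus_iff (t : R) (x : R × R) :
    (x.1, -x.2) ∈ t • ⊤ ⊔ (R ∙ ((1 : R), (1 : R))) ↔ x ∈ t • ⊤ ⊔ (R ∙ ((1 : R), (-1 : R))) := by
  rw [mem_plus_iff, mem_minus_iff, sub_neg_eq_add]

/-- `φ` carries `𝕃⁺` onto `𝕃⁻`, elementwise: `(x₁, -x₂) ∈ 𝕃⁻ ⟺ x ∈ 𝕃⁺`. -/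
theorem flip_mem_minus_iff (t : R) (x : R × R) :
    (x.1, -x.2) ∈ t • ⊤ ⊔ (R ∙ ((1 : R), (-1 : R))) ↔ x ∈ t • ⊤ ⊔ (R ∙ ((1 : R), (1 : R))) := by
  rw [mem_minus_iff, mem_plus_iff, ← sub_eq_add_neg]

/-- `φ(𝕃′) = 𝕃′`. -/
theorem map_flip_smul_top (t : R) :
    (t • (⊤ : Submodule R (R × R))).map ((LinearMap.id : R →ₗ[R] R).prodMap (-LinearMap.id)) = t • ⊤ := by
  ext x
  rw [mem_map_flip_iff, flip_mem_smul_top_iff]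

/-- `φ(𝕃″) = 𝕃″`. -/
theorem map_flip_top :
    (⊤ : Submodule R (R × R)).map ((LinearMap.id : R →ₗ[R] R).prodMap (-LinearMap.id)) = ⊤ := by
  ext x
  simp only [mem_map_flip_iff, Submodule.mem_top]

/-- `φ(𝕃⁺) = 𝕃⁻` — the two sign lattices are exchanged by the sign flip. -/
theorem map_flip_plus (t : R) :
    (t • ⊤ ⊔ (R ∙ ((1 : R), (1 : R)))).map ((LinearMap.id : R →ₗ[R] R).prodMap (-LinearMap.id)) =
      t • ⊤ ⊔ (R ∙ ((1 : R), (-1 : R))) := by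
  ext x
  rw [mem_map_flip_iff, flip_mem_plus_iff]

/-- `φ(𝕃⁻) = 𝕃⁺`. -/
theorem map_flip_minus (t : R) :
    (t • ⊤ ⊔ (R ∙ ((1 : R), (-1 : R)))).map ((LinearMap.id : R →ₗ[R] R).prodMap (-LinearMap.id)) =
      t • ⊤ ⊔ (R ∙ ((1 : R), (1 : R))) := by
  ext x
  rw [mem_map_flip_iff, flip_mem_minus_iff]

/-- `φ` preserves swap-stability (`c ∘ φ = -(φ ∘ c)` and lattices are stable under `-1`). -/
theorem swap_stable_map_flip {L : Submodule R (R × R)} (hswap : ∀ x ∈ L, (x.2, x.1) ∈ L) :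
    ∀ x ∈ L.map ((LinearMap.id : R →ₗ[R] R).prodMap (-LinearMap.id)),
      (x.2, x.1) ∈ L.map ((LinearMap.id : R →ₗ[R] R).prodMap (-LinearMap.id)) := by
  intro x hx
  rw [mem_map_flip_iff] at hx ⊢
  simpa using L.neg_mem (hswap _ hx)

/-- `φ` preserves `(t)`-saturation. -/
theorem saturated_map_flip {t : R} {L : Submodule R (R × R)}
    (hsat : ∀ (s : R) (x : R × R), ¬ t ∣ s → s • x ∈ L → x ∈ L) :
    ∀ (s : R) (x : R × R), ¬ t ∣ s → s • x ∈ L.map ((LinearMap.id : R →ₗ[R] R).prodMap (-LinearMap.id)) →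
      x ∈ L.map ((LinearMap.id : R →ₗ[R] R).prodMap (-LinearMap.id)) := by
  intro s x hs hx
  rw [mem_map_flip_iff] at hx ⊢
  refine hsat s _ hs ?_
  simpa [mul_neg] using hx

/-! ## §2 The `ε = −` twins omitted from p471034 (REPORT-bstw-11 o2) -/

/-- Converse, sign `-`: `𝕃⁻` is `(t)`-saturated when `(t)` is prime (twin of `saturated_plus`). -/
theorem saturated_minus {t : R} (hp : (Ideal.span {t}).IsPrime) (s : R) (x : R × R) (hs : ¬ t ∣ s)
    (hx : s • x ∈ t • ⊤ ⊔ (R ∙ ((1 : R), (-1 : R)))) : x ∈ t • ⊤ ⊔ (R ∙ ((1 : R), (-1 : R))) := by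
  rw [mem_minus_iff] at hx ⊢
  simp only [Prod.smul_fst, Prod.smul_snd, smul_eq_mul, ← mul_add] at hx
  exact (dvd_or_dvd hp hx).resolve_left hs

/-- `𝕃⁻ ∩ 𝕍_v = T_v·𝕃″_v` (Lemma 3.15(ii) for the sign `-`; twin of `plus_inf_fst_axis`). -/
theorem minus_inf_fst_axis (t : R) :
    (t • ⊤ ⊔ (R ∙ ((1 : R), (-1 : R)))) ⊓ Submodule.prod ⊤ ⊥ = Submodule.prod (Ideal.span {t}) ⊥ := by
  ext x
  simp only [Submodule.mem_inf, mem_minus_iff, Submodule.mem_prod, Submodule.mem_top, true_and,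
    Submodule.mem_bot, Ideal.mem_span_singleton]
  constructor
  · rintro ⟨h, h0⟩
    rw [h0, add_zero] at h
    exact ⟨h, h0⟩
  · rintro ⟨h, h0⟩
    rw [h0, add_zero]
    exact ⟨h, rfl⟩

/-- `𝕃⁻ < ⊤` for a non-unit `t` (`(1, 0) ∉ 𝕃⁻`; twin of `plus_lt_top`). -/
theorem minus_lt_top {t : R} (ht : ¬ IsUnit t) : t • ⊤ ⊔ (R ∙ ((1 : R), (-1 : R))) < ⊤ := by
  refine lt_top_iff_ne_top.2 fun h => ht ?_
  have hmem : ((1 : R), (0 : R)) ∈ t • ⊤ ⊔ (R ∙ ((1 : R), (-1 : R))) := h.ge Submodule.mem_top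
  rw [mem_minus_iff] at hmem
  exact isUnit_of_dvd_one (by simpa using hmem)

/-- `𝕃⁻` is NOT induced (for `t` a non-unit): the sum of its `v`- and `v̄`-parts misses `(1, -1)` (twin of
`plus_ne_inf_sup_inf`). -/
theorem minus_ne_inf_sup_inf {t : R} (ht : ¬ IsUnit t) :
    (t • ⊤ ⊔ (R ∙ ((1 : R), (-1 : R)))) ⊓ Submodule.prod ⊤ ⊥ ⊔
        (t • ⊤ ⊔ (R ∙ ((1 : R), (-1 : R)))) ⊓ Submodule.prod ⊥ ⊤ ≠ t • ⊤ ⊔ (R ∙ ((1 : R), (-1 : R))) := by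
  intro h
  have hmem : ((1 : R), (-1 : R)) ∈ t • ⊤ ⊔ (R ∙ ((1 : R), (-1 : R))) :=
    Submodule.mem_sup_right (Submodule.mem_span_singleton_self _)
  rw [← h] at hmem
  obtain ⟨y, hy, z, hz, hyz⟩ := Submodule.mem_sup.1 hmem
  obtain ⟨hy, hy'⟩ := Submodule.mem_inf.1 hy
  obtain ⟨-, hz'⟩ := Submodule.mem_inf.1 hz
  have hy2 : y.2 = 0 := (Submodule.mem_prod.1 hy').2
  have hz1 : z.1 = 0 := (Submodule.mem_prod.1 hz').1
  have hy1 : y.1 = 1 := by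
    have := congrArg Prod.fst hyz
    rwa [Prod.fst_add, hz1, add_zero] at this
  have h1 : t ∣ (1 : R) := by
    have := (mem_minus_iff t y).1 hy
    rwa [hy2, add_zero, hy1] at this
  exact ht (isUnit_of_dvd_one h1)

/-- **REPORT-bstw-11 o2 — MEMO-11 Theorem A Case `D_v = 1` / Theorem B rigidity for the (F3)-class `-`:** if
`ℍ̃ ∈ {J, J⁺, J⁻}` contains `𝕋̃ = J⁻` then `ℍ̃ = J⁻` (since `J ⊉ J⁻` and `J⁺ ⊉ J⁻` for `2 ∉ (t)`; twin of `eq_of_plus_le`). -/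
theorem eq_of_minus_le {t : R} (ht : ¬ IsUnit t) (h2 : ¬ t ∣ 2) {H : Submodule R (R × R)}
    (hH : H = t • ⊤ ∨ H = t • ⊤ ⊔ (R ∙ ((1 : R), (1 : R))) ∨ H = t • ⊤ ⊔ (R ∙ ((1 : R), (-1 : R))))
    (hle : t • ⊤ ⊔ (R ∙ ((1 : R), (-1 : R))) ≤ H) : H = t • ⊤ ⊔ (R ∙ ((1 : R), (-1 : R))) := by
  rcases hH with rfl | rfl | rfl
  · exact absurd (le_antisymm le_sup_left hle) (smul_top_lt_minus ht).ne
  · exact (not_minus_le_plus h2 hle).elim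
  · rfl

/-! ## §3 Sign-uniform rigidity (a Theorem-B consumer need not know the (F3)-class `ε`) -/

/-- Rigidity for either sign `s ∈ {1, -1}`: `t • ⊤ ⊔ R ∙ (1, s) ≤ ℍ̃ ∈ {J, J⁺, J⁻}` forces `ℍ̃ = t • ⊤ ⊔ R ∙ (1, s)`. -/
theorem eq_of_signed_le {t : R} (ht : ¬ IsUnit t) (h2 : ¬ t ∣ 2) {s : R} (hs : s = 1 ∨ s = -1)
    {H : Submodule R (R × R)}
    (hH : H = t • ⊤ ∨ H = t • ⊤ ⊔ (R ∙ ((1 : R), (1 : R))) ∨ H = t • ⊤ ⊔ (R ∙ ((1 : R), (-1 : R))))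
    (hle : t • ⊤ ⊔ (R ∙ ((1 : R), s)) ≤ H) : H = t • ⊤ ⊔ (R ∙ ((1 : R), s)) := by
  rcases hs with rfl | rfl
  · exact eq_of_plus_le ht h2 hH hle
  · exact eq_of_minus_le ht h2 hH hle

/-- The same with the classification built in: for `(t)` prime, `2 ∉ (t)`, a swap-stable `(t)`-saturated `ℍ̃ ≠ 𝕃″`
containing `𝕃^s = t • ⊤ ⊔ R ∙ (1, s)` (`s = ±1`) equals `𝕃^s` (`eq_of_swap_stable_of_saturated` + `eq_of_signed_le`;
`t` is a non-unit because `(t)` is a proper ideal). -/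
theorem eq_signed_of_saturated_of_le {t : R} (hp : (Ideal.span {t}).IsPrime) (h2 : ¬ t ∣ 2) {s : R}
    (hs : s = 1 ∨ s = -1) {H : Submodule R (R × R)} (hswap : ∀ x ∈ H, (x.2, x.1) ∈ H)
    (hsat : ∀ (r : R) (x : R × R), ¬ t ∣ r → r • x ∈ H → x ∈ H) (htop : H ≠ ⊤)
    (hle : t • ⊤ ⊔ (R ∙ ((1 : R), s)) ≤ H) : H = t • ⊤ ⊔ (R ∙ ((1 : R), s)) := by
  have ht : ¬ IsUnit t := fun hu => hp.ne_top (Ideal.span_singleton_eq_top.2 hu)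
  rcases eq_of_swap_stable_of_saturated hp h2 hswap (le_trans le_sup_left hle) hsat with h | h | h | h
  · exact eq_of_signed_le ht h2 hs (Or.inl h) hle
  · exact eq_of_signed_le ht h2 hs (Or.inr (Or.inl h)) hle
  · exact eq_of_signed_le ht h2 hs (Or.inr (Or.inr h)) hle
  · exact (htop h).elim

end Summit.BirchSwinnertonDyer.BirchSwinnertonDyer.Theorems.SignLattices
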